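import Mathlib
import Summits.QuantumFields.QCD.Theorems.MultibosonBridgeAdmissibleRootsBinomialTail
import Summits.QuantumFields.QCD.Theorems.MultibosonBridgeAdmissibleRootsChebyshevSquare

/-!
# `MultibosonBridge.AdmissibleRootsExistR` (item stmt-QuantumFields-10699) — the two estimates

Band and gap estimates for the approximation of `1/|t|` built in
`MultibosonBridgeAdmissibleRootsExistR.lean` (see its module docstring for the construction).
With `r = √ε`, `ρ = (1-r)/(1+r)`, weights `w_j = b_j ρ^j` (`b_j = Ring.multichoose (1/4) j`),
`Q_w = Σ_{j,k ≤ m} w_j w_k T_{j-k}` and `y = (1 + ε - 2s)/(1 - ε)`: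

* `band_estimate` — for `s ∈ [ε, 1]`:
  `(1 - 2ρ^{m+1})⁴ ≤ √s (2/(1+r)) Q_w(y)² ≤ (1 + 2ρ^{m+1})⁴` when `(m+1) r ≥ 1`, `2ρ^{m+1} ≤ 1`
  (at `y = cos θ`, `Q_w(y) = |f_m(z)|²`, `z = ρe^{iθ}`, `|1 - z| = 2√s/(1+r)`, and the Abel tail
  bound of the helper file *BinomialTail* gives `|f_m| ∈ |f| (1 ∓ 2ρ^{m+1})`, `|f|⁴ = 1/|1-z|`);
* `gap_estimate` — for `s ∈ (0, ε]`: `√s (2/(1+r)) Q_w(y)² ≤ 1` (at `y = cosh u`,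
  `Q_w(y) = f_m(ρe^u) f_m(ρe^{-u}) ≤ ((1-ρe^u)(1-ρe^{-u}))^{-1/4} = (4s/(1+r)²)^{-1/4}`).

Elementary, definition-free, no named facts. Nothing about QCD or Yang–Mills is proved here.
-/

noncomputable section

open scoped BigOperators ComplexConjugate
open Complex Finset Polynomial

namespace Summit.QuantumFields.QCD.Theorems.MultibosonBridge.AdmissibleRoots

/-- `0 < √ε < 1` for `0 < ε < 1`. -/
theorem sqrt_bounds {ε : ℝ} (hε0 : 0 < ε) (hε1 : ε < 1) :
    0 < Real.sqrt ε ∧ Real.sqrt ε < 1 := by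
  refine ⟨Real.sqrt_pos.mpr hε0, ?_⟩
  rw [show (1 : ℝ) = Real.sqrt 1 by simp]
  exact Real.sqrt_lt_sqrt hε0.le hε1

/-! ### The band estimate `√ε ≤ x ≤ 1` -/

/-- **Band estimate.** For `s ∈ [ε, 1]`, `y = (1+ε-2s)/(1-ε)` and the weights `w_j = b_j ρ^j`:
`(1 - 2ρ^{m+1})⁴ ≤ √s · (2/(1+√ε)) · Q_w(y)² ≤ (1 + 2ρ^{m+1})⁴`, provided `(m+1)√ε ≥ 1` and
`2ρ^{m+1} ≤ 1`. -/
theorem band_estimate {ε : ℝ} (hε0 : 0 < ε) (hε1 : ε < 1) (m : ℕ)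
    (hm : 1 ≤ ((m : ℝ) + 1) * Real.sqrt ε)
    (hη : 2 * ((1 - Real.sqrt ε) / (1 + Real.sqrt ε)) ^ (m + 1) ≤ 1)
    (w : ℕ → ℝ)
    (hw : ∀ j, w j = Ring.multichoose (1 / 4 : ℝ) j * ((1 - Real.sqrt ε) / (1 + Real.sqrt ε)) ^ j)
    {s : ℝ} (hs0 : ε ≤ s) (hs1 : s ≤ 1) :
    (1 - 2 * ((1 - Real.sqrt ε) / (1 + Real.sqrt ε)) ^ (m + 1)) ^ 4 ≤
        Real.sqrt s * (2 / (1 + Real.sqrt ε)) *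
          ((∑ j ∈ range (m + 1), ∑ k ∈ range (m + 1),
              C (w j * w k) * Chebyshev.T ℝ ((j : ℤ) - k)).eval ((1 + ε - 2 * s) / (1 - ε))) ^ 2 ∧
      Real.sqrt s * (2 / (1 + Real.sqrt ε)) *
          ((∑ j ∈ range (m + 1), ∑ k ∈ range (m + 1),
              C (w j * w k) * Chebyshev.T ℝ ((j : ℤ) - k)).eval ((1 + ε - 2 * s) / (1 - ε))) ^ 2 ≤
        (1 + 2 * ((1 - Real.sqrt ε) / (1 + Real.sqrt ε)) ^ (m + 1)) ^ 4 := by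
  obtain ⟨hr0, hr1⟩ := sqrt_bounds hε0 hε1
  obtain ⟨hρ0, hρ1, hρle⟩ := rho_bounds hε0 hε1
  set r := Real.sqrt ε with hr
  set ρ := (1 - r) / (1 + r) with hρ
  set y := (1 + ε - 2 * s) / (1 - ε) with hy
  have hspos : 0 < s := lt_of_lt_of_le hε0 hs0
  have hy1 : -1 ≤ y := by
    rw [hy, le_div_iff₀ (by linarith)]; linarith
  have hy2 : y ≤ 1 := by
    rw [hy, div_le_iff₀ (by linarith)]; linarith
  set θ := Real.arccos y with hθ
  have hcos : Real.cos θ = y := Real.cos_arccos hy1 hy2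
  set z : ℂ := (ρ : ℂ) * exp (θ * I) with hz
  have hnz : ‖z‖ = ρ := norm_rho_exp hρ0 θ
  have hz1 : ‖z‖ < 1 := by rw [hnz]; exact hρ1
  -- |1 - z| = 2 √s / (1 + r)
  have hsx : Real.sqrt s ^ 2 = s := Real.sq_sqrt hspos.le
  have hsqpos : 0 < Real.sqrt s := Real.sqrt_pos.mpr hspos
  have hd2 : ‖1 - z‖ ^ 2 = (2 * Real.sqrt s / (1 + r)) ^ 2 := by
    rw [hz, norm_one_sub_rho_exp_sq, hcos, hρ, hy, hr, one_sub_two_mul_rho hε0 hε1 s, ← hr,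
      div_pow, mul_pow, hsx]
    ring
  have hd : ‖1 - z‖ = 2 * Real.sqrt s / (1 + r) := by
    have h := (sq_eq_sq₀ (norm_nonneg _) (by positivity)).mp hd2
    exact h
  have hdpos : 0 < ‖1 - z‖ := by rw [hd]; positivity
  -- Q(y) = ‖f_m(z)‖²
  set Pm : ℂ := ∑ n ∈ range (m + 1), ((Ring.multichoose (1 / 4 : ℝ) n : ℝ) : ℂ) * z ^ n with hPm
  have hQ : (∑ j ∈ range (m + 1), ∑ k ∈ range (m + 1),
      C (w j * w k) * Chebyshev.T ℝ ((j : ℤ) - k)).eval y = ‖Pm‖ ^ 2 := by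
    rw [← hcos, eval_cos_sqPoly]
    congr 2
    refine sum_congr rfl fun j _ => ?_
    rw [hw j, weight_mul_exp_pow]
  -- the full series and its norm
  set f : ℂ := 1 / (1 - z) ^ (1 / 4 : ℂ) with hf
  have hf4 : ‖f‖ ^ 4 = 1 / ‖1 - z‖ := norm_quarticInv_pow_four hz1
  have hfpos : 0 < ‖f‖ := norm_quarticInv_pos hz1
  -- tail bound
  have hm2 : 1 ≤ ((m : ℝ) + 2) * ‖1 - z‖ := by
    rw [hd]
    have h1 : r ≤ Real.sqrt s := by rw [hr]; exact Real.sqrt_le_sqrt (by nlinarith [Real.sq_sqrt hε0.le])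
    have h2 : Real.sqrt s ≤ 2 * Real.sqrt s / (1 + r) := by
      rw [le_div_iff₀ (by linarith)]; nlinarith
    nlinarith
  have htail : ‖f - Pm‖ ≤ 2 * ρ ^ (m + 1) * ‖f‖ := by
    have h := norm_tail_le_of hz1 m hm2
    rw [hnz] at h
    exact h
  set η := 2 * ρ ^ (m + 1) with hηdef
  have hη0 : 0 ≤ η := by positivity
  -- ‖Pm‖ between ‖f‖(1-η) and ‖f‖(1+η)
  have hPup : ‖Pm‖ ≤ ‖f‖ * (1 + η) := by
    have := norm_sub_norm_le Pm f
    rw [norm_sub_rev] at this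
    nlinarith
  have hPlo : ‖f‖ * (1 - η) ≤ ‖Pm‖ := by
    have := norm_sub_norm_le f Pm
    nlinarith
  -- the normalisation: √s (2/(1+r)) ‖f‖⁴ = 1
  have hnormal : Real.sqrt s * (2 / (1 + r)) * ‖f‖ ^ 4 = 1 := by
    rw [hf4, hd]
    field_simp
  rw [hQ, ← pow_mul]
  norm_num
  constructor
  · -- lower bound
    have h1 : (‖f‖ * (1 - η)) ^ 4 ≤ ‖Pm‖ ^ 4 :=
      pow_le_pow_left₀ (mul_nonneg hfpos.le (by linarith)) hPlo 4
    calc (1 - η) ^ 4 = Real.sqrt s * (2 / (1 + r)) * ‖f‖ ^ 4 * (1 - η) ^ 4 := by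
          rw [hnormal, one_mul]
      _ = Real.sqrt s * (2 / (1 + r)) * (‖f‖ * (1 - η)) ^ 4 := by ring
      _ ≤ Real.sqrt s * (2 / (1 + r)) * ‖Pm‖ ^ 4 := by gcongr
  · -- upper bound
    have h1 : ‖Pm‖ ^ 4 ≤ (‖f‖ * (1 + η)) ^ 4 := pow_le_pow_left₀ (norm_nonneg _) hPup 4
    calc Real.sqrt s * (2 / (1 + r)) * ‖Pm‖ ^ 4
        ≤ Real.sqrt s * (2 / (1 + r)) * (‖f‖ * (1 + η)) ^ 4 := by gcongr
      _ = Real.sqrt s * (2 / (1 + r)) * ‖f‖ ^ 4 * (1 + η) ^ 4 := by ring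
      _ = (1 + η) ^ 4 := by rw [hnormal, one_mul]

/-! ### The gap estimate `0 < x ≤ √ε` -/

/-- **Gap estimate.** For `s ∈ (0, ε]`: `√s · (2/(1+√ε)) · Q_w(y)² ≤ 1`. -/
theorem gap_estimate {ε : ℝ} (hε0 : 0 < ε) (hε1 : ε < 1) (m : ℕ) (w : ℕ → ℝ)
    (hw : ∀ j, w j = Ring.multichoose (1 / 4 : ℝ) j * ((1 - Real.sqrt ε) / (1 + Real.sqrt ε)) ^ j)
    {s : ℝ} (hs0 : 0 < s) (hs1 : s ≤ ε) :
    Real.sqrt s * (2 / (1 + Real.sqrt ε)) *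
        ((∑ j ∈ range (m + 1), ∑ k ∈ range (m + 1),
            C (w j * w k) * Chebyshev.T ℝ ((j : ℤ) - k)).eval ((1 + ε - 2 * s) / (1 - ε))) ^ 2 ≤
      1 := by
  obtain ⟨hr0, hr1⟩ := sqrt_bounds hε0 hε1
  obtain ⟨hρ0, hρ1, hρle⟩ := rho_bounds hε0 hε1
  set r := Real.sqrt ε with hr
  set ρ := (1 - r) / (1 + r) with hρ
  set y := (1 + ε - 2 * s) / (1 - ε) with hy
  have hy1 : 1 ≤ y := by
    rw [hy, le_div_iff₀ (by linarith)]; linarith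
  set u := Real.arcosh y with hu
  have hcosh : Real.cosh u = y := Real.cosh_arcosh hy1
  have hu0 : 0 ≤ u := Real.arcosh_nonneg hy1
  -- the two real arguments t₁ = ρ e^u, t₂ = ρ e^{-u}
  have hprod : (1 - ρ * Real.exp u) * (1 - ρ * Real.exp (-u)) = 4 * s / (1 + r) ^ 2 := by
    rw [one_sub_rho_exp_mul, hcosh, hρ, hy, hr, one_sub_two_mul_rho hε0 hε1 s]
  have hDpos : 0 < 4 * s / (1 + r) ^ 2 := by positivity
  have ht2 : ρ * Real.exp (-u) < 1 := by
    have : Real.exp (-u) ≤ 1 := by rw [Real.exp_le_one_iff]; linarith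
    calc ρ * Real.exp (-u) ≤ ρ * 1 := by gcongr
      _ < 1 := by linarith
  have ht1 : ρ * Real.exp u < 1 := by
    by_contra h
    push Not at h
    have : (1 - ρ * Real.exp u) * (1 - ρ * Real.exp (-u)) ≤ 0 :=
      mul_nonpos_of_nonpos_of_nonneg (by linarith) (by linarith)
    linarith [hprod ▸ this]
  have ht1' : 0 ≤ ρ * Real.exp u := by positivity
  have ht2' : 0 ≤ ρ * Real.exp (-u) := by positivity
  -- Q(y) = P(t₁) P(t₂)
  set P1 := ∑ n ∈ range (m + 1), Ring.multichoose (1 / 4 : ℝ) n * (ρ * Real.exp u) ^ n with hP1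
  set P2 := ∑ n ∈ range (m + 1), Ring.multichoose (1 / 4 : ℝ) n * (ρ * Real.exp (-u)) ^ n
    with hP2
  have hQ : (∑ j ∈ range (m + 1), ∑ k ∈ range (m + 1),
      C (w j * w k) * Chebyshev.T ℝ ((j : ℤ) - k)).eval y = P1 * P2 := by
    rw [← hcosh, eval_cosh_sqPoly, hP1, hP2]
    congr 1
    · refine sum_congr rfl fun j _ => ?_
      rw [hw j, mul_pow]; ring
    · refine sum_congr rfl fun k _ => ?_
      rw [hw k, mul_pow]; ring
  have hP1nn : 0 ≤ P1 := partialSum_real_nonneg ht1' m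
  have hP2nn : 0 ≤ P2 := partialSum_real_nonneg ht2' m
  have hP1le : P1 ≤ (1 - ρ * Real.exp u) ^ (-(1 / 4 : ℝ)) := partialSum_le_rpow ht1' ht1 m
  have hP2le : P2 ≤ (1 - ρ * Real.exp (-u)) ^ (-(1 / 4 : ℝ)) := partialSum_le_rpow ht2' ht2 m
  -- (P1 P2)^4 ≤ ((1-t₁)(1-t₂))^{-1} = (1+r)²/(4s)
  have hM : (P1 * P2) ^ 4 ≤ ((1 + r) ^ 2 / (4 * s)) := by
    have h1 : P1 * P2 ≤ (1 - ρ * Real.exp u) ^ (-(1 / 4 : ℝ)) *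
        (1 - ρ * Real.exp (-u)) ^ (-(1 / 4 : ℝ)) :=
      mul_le_mul hP1le hP2le hP2nn (Real.rpow_nonneg (by linarith) _)
    have h2 : (P1 * P2) ^ 4 ≤ ((1 - ρ * Real.exp u) ^ (-(1 / 4 : ℝ)) *
        (1 - ρ * Real.exp (-u)) ^ (-(1 / 4 : ℝ))) ^ 4 :=
      pow_le_pow_left₀ (mul_nonneg hP1nn hP2nn) h1 4
    refine h2.trans (le_of_eq ?_)
    rw [← Real.mul_rpow (by linarith) (by linarith), hprod, ← Real.rpow_natCast,
      ← Real.rpow_mul hDpos.le]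
    norm_num
    rw [Real.rpow_neg_one]
    field_simp
  -- conclude by squaring
  have hsx : Real.sqrt s ^ 2 = s := Real.sq_sqrt hs0.le
  have hnn : 0 ≤ Real.sqrt s * (2 / (1 + r)) * (P1 * P2) ^ 2 := by positivity
  rw [hQ]
  rw [← pow_le_one_iff_of_nonneg hnn two_ne_zero]
  calc (Real.sqrt s * (2 / (1 + r)) * (P1 * P2) ^ 2) ^ 2
      = s * (4 / (1 + r) ^ 2) * (P1 * P2) ^ 4 := by rw [mul_pow, mul_pow, hsx, div_pow]; ring
    _ ≤ s * (4 / (1 + r) ^ 2) * ((1 + r) ^ 2 / (4 * s)) := by gcongr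
    _ = 1 := by field_simp

end Summit.QuantumFields.QCD.Theorems.MultibosonBridge.AdmissibleRoots

end
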